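import Literature.Analysis.FluidPDE.AxisymNoSwirlOmegaLpDissipation
import Literature.Analysis.FluidPDE.AxisymNoSwirlStrainDecay
import Literature.Analysis.FluidPDE.AxisymHalfPlaneNash
import Literature.Analysis.FluidPDE.AxisymNoSwirlVelocityDecayOfVorticityBound
import Literature.Analysis.ODE.SingularBernoulliComparison
import Literature.Analysis.FunctionSpaces.SupBoundFromLpBounds
import HarnessLib

/-!
# Axisymmetric flows without swirl: the scale-invariant vorticity bound
# `t ‖ω(t)‖_{L^∞} ≤ C(‖ω₀‖_{L¹(Ω)})` (Gallay–Šverák 2015, (1.11) = Prop. 5.3 for `p = ∞`)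

Analysis/FluidPDE proof file (theorems only; no definitions, no new named facts). It DISCHARGES the
named facts `GallaySverak2015.VorticitySupBound` and (through the tree's
`GallaySverak2015.velocitySupDecay_of_vorticitySupBound`) `GallaySverak2015.VelocitySupDecay` of
`AxisymNoSwirlScaleInvariantBounds.lean`.

> **Proposition 5.3.** Any solution `ω_θ ∈ C⁰([0,T],L¹(Ω)) ∩ C⁰((0,T],L^∞(Ω))` of (2.10) with
> initial data `ω₀ ∈ L¹(Ω)` satisfies, for all `p ∈ [1,∞]`,
> `‖ω_θ(t)‖_{L^p(Ω)} ≤ C_p(‖ω₀‖_{L¹(Ω)}) t^{−(1−1/p)}`, `0 < t ≤ T`, where `C_p(s) = O(s)` as `s → 0`.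

(Th. Gallay, V. Šverák, *Remarks on the Cauchy problem for the axisymmetric Navier–Stokes
equations*, Confluentes Math. 7 (2015) 67–92 = arXiv:1510.01036, §5, arXiv pp. 16–17; (1.11) is
the case `p = ∞`.) The printed proof does `p = 2` by the energy identity (5.8), Nash's inequality on
`Ω` and the bound `‖u_r/r‖_{L^∞} ≤ C‖ω_θ/r‖_{L¹}^{1/3}‖ω_θ/r‖_{L^∞}^{2/3} ≤ CM/t` ((5.9)), and then
"a similar argument" / the semigroup bounds of §3 for `p > 2`. Here the `p > 2` range is done by the
same energy method for ALL even exponents — the Nash–Moser iteration `p ↦ 2p` of Feng–Šverák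
(arXiv:1301.6317, proof of Lemma 3.8, p. 12), transplanted from `L^p(ℝ³)` for `η = ω_θ/r` to
`L^p(Ω, dr dz)` for `ω_θ` — followed by `p → ∞`:

1. (tree, `AxisymNoSwirlOmegaLpDissipation`) the balance `F_k(t) − F_k(s) = ∫ₛᵗ σ_k` for
   `F_k = ∫ r^{2k−1}η^{2k} dx = 2π‖ω_θ‖_{L^{2k}(Ω)}^{2k}` and the slice inequality
   `σ_k + 2(2k−1)k·X_k ≤ (2k−1)‖u_r/r‖_∞ F_k` ((5.8) for `p = 2k`), `r k² X_k = ‖∇(ω_θ^k)‖²`;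
2. (tree, `AxisymHalfPlaneNash`) Nash's inequality on `Ω` in `ℝ³`-variables:
   `F_k² ≤ C_N (∫ r^{k−1}|η|^k)² · k² X_k`, `C_N = 32 C_GNS/c₂`;
3. (tree, `AxisymNoSwirlStrainDecay`) `‖u_r/r‖_∞ ≤ K₂ A/t`, `A = ∫|η₀| = 2π‖ω₀‖_{L¹(Ω)}`,
   `K₂ = 27K₁²/4` (Gallay–Šverák's `CM/t`, from (2.15) and Lemma 5.2);
4. (tree, `SingularBernoulliComparison`) the integrated Bernoulli comparison
   `F' ≤ −a t^m F^{1+γ} + (α/t)F ⇒ F ≤ ((m+1+αγ)/(aγ))^{1/γ} t^{−(m+1)/γ}`;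
5. (here) the base `k = 3` (Hölder `∫ r²|η|³ ≤ ‖η‖₁^{3/5} F_3^{2/5}`, `γ = 1/5`):
   `F_3 ≤ (3C⁺/2)^5 (1+K₂A)^5 A^6 t^{−5}`; the doubling `k ↦ 2k` (`γ = 1`):
   `F_{2k} ≤ C⁺ k (1+K₂A) B_k² t^{−(4k−1)}` if `F_k ≤ B_k t^{−(2k−1)}`; the recursion solved in
   closed form along `k = 3·2ⁿ`; and `p → ∞` on the continuous slice `ω_θ = rη` for the measure
   `dx/r` (tree, `SupBoundFromLpBounds`), giving
   `t‖ω(t,x)‖ = t·r|η(t,x)| ≤ 3 C⁺ (1 + K₂A) A` (`C⁺ = max(C_N, 1)`), hence (1.11) with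
   `C(M) = 6πC⁺ M (1 + 2πK₂M) = O(M)`.

* `IsTaoSolutionOn.mul_norm_curl_le_of_datum` — the bound `t ‖ω(t, x)‖ ≤ 3C⁺(1+K₂A)A`.
* `GallaySverak2015.VorticitySupBound_holds`, `GallaySverak2015.VelocitySupDecay_holds` — the
  discharges.

WHAT THIS IS NOT: not a regularity or blow-up criterion — an a-priori decay estimate for smooth
axisymmetric swirl-free solutions; measure-valued data, uniqueness (Thm. 1.3 of the paper) and the
sharp constants are not addressed.

## Mathlib / tree search

Tree (used): `IsTaoSolutionOn.integral_weight_pow_mul_angVortQuot_deriv_add_dissipation_le`,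
`…integral_weight_pow_angVortQuot_balance`, `…memLp_cylRadius_mul_angVortQuot`,
`…exists_forall_cylRadius_mul_abs_angVortQuot_le`, `cylRadius_mul_sq_mul_dissipDensity_eq_norm_fderiv_sq`,
`contDiff_one_cylRadius_pow_mul_pow` (`AxisymNoSwirlOmegaLpDissipation`); `sq_integral_le_nash_halfPlane`
(`AxisymHalfPlaneNash`); `IsTaoSolutionOn.abs_radVelQuot_le_nash_of_datum` (`AxisymNoSwirlStrainDecay`);
`Literature.Analysis.ODE.le_mul_rpow_of_sub_eq_integral_of_slice_le`;
`Literature.Analysis.FunctionSpaces.norm_le_of_lintegral_rpow_le_of_tendsto`;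
`IsTaoSolutionOn.lintegral_abs_angVortQuot_le` (Lemma 5.1), `…isAxisymmetric`, `…hasNoSwirl`,
`norm_curl_eq_cylRadius_mul_abs_angVortQuot`, `volume_setOf_cylRadius_eq_zero`,
`GallaySverak2015.velocitySupDecay_of_vorticitySupBound`. `lean search 'VorticitySupBound_holds|mul_norm_curl_le'`
(2026-08-27): the fact was undischarged. Mathlib: `integral_mul_le_Lp_mul_Lq_of_nonneg` (Hölder),
`integrable_norm_rpow_iff`, `lintegral_withDensity_eq_lintegral_mul`, `withDensity_apply_eq_zero'`,
`Real.continuousAt_const_rpow`, `Continuous.ae_eq_iff_eq`.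

## References

* Th. Gallay, V. Šverák, Confluentes Math. 7 (2015) 67–92 = arXiv:1510.01036, §1 (1.11), §5
  Prop. 5.3 and its proof (5.8)–(5.10) (arXiv pp. 4, 16–17). [GallaySverak2016]
* H. Feng, V. Šverák, Arch. Ration. Mech. Anal. 215 (2015) 89–123 = arXiv:1301.6317, proof of
  Lemma 3.8 (arXiv p. 12). [FengSverak2015]
* J. Nash, Amer. J. Math. 80 (1958) 931–954. [Nash1958]
-/

noncomputable section

open MeasureTheory Set Function Filter Topology InnerProductSpace WithLp
open scoped RealInnerProductSpace ContDiff ENNReal NNReal Topology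
open Literature.Analysis.ODE Literature.Analysis.FunctionSpaces

namespace Literature.Analysis.FluidPDE

namespace AxisymNoSwirlVorticitySupBound

variable {T ν : ℝ} {u₀ : EuclideanSpace ℝ (Fin 3) → EuclideanSpace ℝ (Fin 3)}
  {v : ℝ → EuclideanSpace ℝ (Fin 3) → EuclideanSpace ℝ (Fin 3)} {q : ℝ → EuclideanSpace ℝ (Fin 3) → ℝ}

/-! ### Private plumbing -/

/-- A continuous function bounded by `C` times an integrable one is integrable. [folklore] -/
private theorem integrable_bdd_mul {f g : EuclideanSpace ℝ (Fin 3) → ℝ} (C : ℝ) (hf : Continuous f)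
    (hC : ∀ x, |f x| ≤ C) (hg : Integrable g) : Integrable fun x => f x * g x :=
  hg.bdd_mul hf.aestronglyMeasurable (ae_of_all _ fun x => by rw [Real.norm_eq_abs]; exact hC x)

/-- `|rη|ⁿ ≤ Lⁿ` when `r|η| ≤ L`. [folklore] -/
private theorem abs_cylRadius_mul_pow_le {η : EuclideanSpace ℝ (Fin 3) → ℝ} {L : ℝ}
    (hL : ∀ x, cylRadius x * |η x| ≤ L) (n : ℕ) (x : EuclideanSpace ℝ (Fin 3)) :
    |cylRadius x * η x| ^ n ≤ L ^ n := by
  have h1 : |cylRadius x * η x| ≤ L := by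
    rw [abs_mul, abs_of_nonneg (cylRadius_nonneg x)]; exact hL x
  exact pow_le_pow_left₀ (abs_nonneg _) h1 n

/-- `x ↦ r(x)` is an axisymmetric scalar. [folklore] -/
private theorem isAxisymmetricScalar_cylRadius' :
    IsAxisymmetricScalar (cylRadius : EuclideanSpace ℝ (Fin 3) → ℝ) := fun θ x => cylRadius_rotZ θ x

/-- For a linear functional on `ℝ³`, `‖L‖² = ∑ᵢ L(eᵢ)²` (Riesz). [folklore] -/
private theorem norm_sq_eq_sum_sq_single' (L : EuclideanSpace ℝ (Fin 3) →L[ℝ] ℝ) :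
    ‖L‖ ^ 2 = ∑ i : Fin 3, (L (EuclideanSpace.single i (1 : ℝ))) ^ 2 := by
  set w : EuclideanSpace ℝ (Fin 3) := (InnerProductSpace.toDual ℝ (EuclideanSpace ℝ (Fin 3))).symm L
    with hw
  have hL : ∀ z, L z = ⟪w, z⟫ := fun z => by rw [hw, InnerProductSpace.toDual_symm_apply]
  have hn : ‖L‖ = ‖w‖ := by rw [hw, LinearIsometryEquiv.norm_map]
  rw [hn, EuclideanSpace.real_norm_sq_eq]
  refine Finset.sum_congr rfl fun i _ => ?_
  rw [hL, EuclideanSpace.inner_single_right]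
  simp

/-- **`L¹` data of the slices** (Gallay–Šverák's Lemma 5.1 in the tree): if `η(0) ∈ L¹` then every
`η(τ)`, `τ ∈ [0, T]`, is integrable with `∫ |η(τ)| ≤ ∫ |η(0)|`.
[cite: GallaySverak2016, §5 Lemma 5.1 (arXiv p. 16)] -/
private theorem l1_slice (h : IsTaoSolutionOn T ν u₀ v q) (hT : 0 < T) (hν : 0 ≤ ν)
    (hax : ∀ t ∈ Icc 0 T, IsAxisymmetric (v t)) (hsw : ∀ t ∈ Icc 0 T, HasNoSwirl (v t))
    (hL1 : Integrable (angVortQuot (v 0))) {τ : ℝ} (hτ : τ ∈ Icc 0 T) :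
    Integrable (angVortQuot (v τ)) ∧
      (∫ x, |angVortQuot (v τ) x|) ≤ ∫ x, |angVortQuot (v 0) x| := by
  have hvs : ContDiff ℝ ∞ (v τ) := h.classical.contDiff_velocity hτ
  have hηc : Continuous (angVortQuot (v τ)) := (contDiff_angVortQuot_of_contDiff hvs).continuous
  have hlin := h.lintegral_abs_angVortQuot_le hT hν hax hsw (s := 0) (t := τ) ⟨le_rfl, hT.le⟩ hτ hτ.1
  have hfin : ∫⁻ x, ‖angVortQuot (v 0) x‖ₑ < ⊤ := hasFiniteIntegral_iff_enorm.1 hL1.hasFiniteIntegral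
  have hint : Integrable (angVortQuot (v τ)) :=
    ⟨hηc.aestronglyMeasurable, hasFiniteIntegral_iff_enorm.2 (hlin.trans_lt hfin)⟩
  refine ⟨hint, ?_⟩
  have e1 : ENNReal.ofReal (∫ x, |angVortQuot (v τ) x|) = ∫⁻ x, ‖angVortQuot (v τ) x‖ₑ := by
    rw [← ofReal_integral_norm_eq_lintegral_enorm hint]
    simp only [Real.norm_eq_abs]
  have e0 : ENNReal.ofReal (∫ x, |angVortQuot (v 0) x|) = ∫⁻ x, ‖angVortQuot (v 0) x‖ₑ := by
    rw [← ofReal_integral_norm_eq_lintegral_enorm hL1]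
    simp only [Real.norm_eq_abs]
  have hle : ENNReal.ofReal (∫ x, |angVortQuot (v τ) x|) ≤ ENNReal.ofReal (∫ x, |angVortQuot (v 0) x|) := by
    rw [e1, e0]; exact hlin
  exact (ENNReal.ofReal_le_ofReal_iff (integral_nonneg fun x => abs_nonneg _)).1 hle

/-- **Nash's inequality on `Ω` for the slice `ω_θ(τ)^k`, `k ≥ 3`**, in Tao's class with
axisymmetric slices: with `η = angVortQuot (v τ)`, `F_k = ∫ r^{2k−1}η^{2k}`,
`X_k = ∫ (r^{2k−3}η^{2k} + 2r^{2k−1}η^{2k−1}(∂ᵣη)/r + r^{2k−1}η^{2k−2}‖Dη‖²)` (`r k² X_k`-integrand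
`= ‖∇(ω_θ^k)‖²`): `F_k² ≤ C_N (∫ r^{k−1}|η|^k)² · k² X_k`, `C_N = 32C_GNS/c₂`
(`sq_integral_le_nash_halfPlane` with `h = r^k η^k = ω_θ^k`); also `r^{2k−1}η^{2k}`,
`r^{k−1}|η|^k ∈ L¹`. [cite: GallaySverak2016, proof of Prop. 5.3, "The celebrated Nash inequality"
(arXiv p. 16); Nash1958, p. 936] -/
private theorem nash_slice (h : IsTaoSolutionOn T ν u₀ v q) (hax : ∀ t ∈ Icc 0 T, IsAxisymmetric (v t))
    {k : ℕ} (hk : 3 ≤ k) {τ : ℝ} (hτ : τ ∈ Icc 0 T) :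
    (∫ x, cylRadius x ^ (2 * k - 1) * angVortQuot (v τ) x ^ (2 * k)) ^ 2 ≤
      32 * (lintegralPowLePowLIntegralFDerivConst (volume : Measure (EuclideanSpace ℝ (Fin 2))) 2 : ℝ) /
        radialConst₂ * (∫ x, cylRadius x ^ (k - 1) * |angVortQuot (v τ) x| ^ k) ^ 2 *
        ((k : ℝ) ^ 2 * ∫ x, (cylRadius x ^ (2 * k - 3) * angVortQuot (v τ) x ^ (2 * k) +
          2 * cylRadius x ^ (2 * k - 1) * angVortQuot (v τ) x ^ (2 * k - 1) *
            radDerivQuot (angVortQuot (v τ)) x +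
          cylRadius x ^ (2 * k - 1) * angVortQuot (v τ) x ^ (2 * k - 2) *
            ‖fderiv ℝ (angVortQuot (v τ)) x‖ ^ 2)) ∧
    Integrable (fun x => cylRadius x ^ (2 * k - 1) * angVortQuot (v τ) x ^ (2 * k)) ∧
    Integrable (fun x => cylRadius x ^ (k - 1) * |angVortQuot (v τ) x| ^ k) ∧
    0 ≤ ∫ x, (cylRadius x ^ (2 * k - 3) * angVortQuot (v τ) x ^ (2 * k) +
          2 * cylRadius x ^ (2 * k - 1) * angVortQuot (v τ) x ^ (2 * k - 1) *
            radDerivQuot (angVortQuot (v τ)) x +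
          cylRadius x ^ (2 * k - 1) * angVortQuot (v τ) x ^ (2 * k - 2) *
            ‖fderiv ℝ (angVortQuot (v τ)) x‖ ^ 2) := by
  obtain ⟨m, rfl⟩ : ∃ m, k = m + 3 := ⟨k - 3, by omega⟩
  have n1 : 2 * (m + 3) - 1 = 2 * m + 5 := by omega
  have n2 : 2 * (m + 3) - 2 = 2 * m + 4 := by omega
  have n3 : 2 * (m + 3) - 3 = 2 * m + 3 := by omega
  have n4 : m + 3 - 1 = m + 2 := by omega
  have n0 : 2 * (m + 3) = 2 * m + 6 := by omega
  simp only [n1, n2, n3, n4]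
  simp only [n0]
  push_cast
  -- data
  set η : EuclideanSpace ℝ (Fin 3) → ℝ := angVortQuot (v τ) with hη
  have hvs : ContDiff ℝ ∞ (v τ) := h.classical.contDiff_velocity hτ
  have hv3 : ContDiff ℝ 3 (v τ) := hvs.of_le (by norm_cast)
  have hηs : ContDiff ℝ ∞ η := contDiff_angVortQuot_of_contDiff hvs
  have hη2 : ContDiff ℝ 2 η := hηs.of_le (by norm_cast)
  have hη1 : ContDiff ℝ 1 η := hηs.of_le (by norm_cast)
  have hηc : Continuous η := hηs.continuous
  have hηd : Differentiable ℝ η := hηs.differentiable (by simp)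
  have hηax : IsAxisymmetricScalar η := (hax τ hτ).isAxisymmetricScalar_angVortQuot hv3
  obtain ⟨F, -, hF⟩ := h.exists_forall_abs_angVortQuot_le hax
  obtain ⟨L, hL0, hL⟩ := h.exists_forall_cylRadius_mul_abs_angVortQuot_le hax
  have hFτ : ∀ x, |η x| ≤ F := hF τ hτ
  have hLτ : ∀ x, cylRadius x * |η x| ≤ L := hL τ hτ
  have hF0 : 0 ≤ F := (abs_nonneg _).trans (hFτ 0)
  obtain ⟨m0, -, -, mq⟩ := h.memLp_angVortQuot_data hax hτ
  obtain ⟨mG, mGD⟩ := h.memLp_cylRadius_mul_angVortQuot hax hτ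
  have hr0 : ∀ x : EuclideanSpace ℝ (Fin 3), 0 ≤ cylRadius x := cylRadius_nonneg
  have hrc : Continuous (cylRadius : EuclideanSpace ℝ (Fin 3) → ℝ) := continuous_cylRadius
  have hqc : Continuous (radDerivQuot η) := continuous_radDerivQuot hη2
  have hDc : Continuous fun x => ‖fderiv ℝ η x‖ := (hη1.continuous_fderiv one_ne_zero).norm
  -- axisymmetry of the pieces
  have hqax : IsAxisymmetricScalar (radDerivQuot η) := isAxisymmetricScalar_radDerivQuot hη2 hηax
  have hDax : ∀ θ x, ‖fderiv ℝ η (rotZ θ x)‖ = ‖fderiv ℝ η x‖ := fun θ x => hηax.norm_fderiv hηd θ x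
  -- basic `L¹` products
  have iGG : Integrable fun x => cylRadius x * η x * (cylRadius x * η x) := mG.integrable_mul mG
  have iGη : Integrable fun x => cylRadius x * η x * η x := mG.integrable_mul m0
  have iGq : Integrable fun x => cylRadius x * η x * radDerivQuot η x := mG.integrable_mul mq
  have iRD : ∀ i : Fin 3, Integrable fun x => (cylRadius x * fderiv ℝ η x (EuclideanSpace.single i 1)) *
      (cylRadius x * fderiv ℝ η x (EuclideanSpace.single i 1)) := fun i => (mGD i).integrable_mul (mGD i)
  -- the three functions of Nash's inequality
  -- `X₁ = r^{m+2} |η|^{m+3} = (r|η|)^{m+1} · (r|η| · |η|)`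
  have iX₁ : Integrable fun x => cylRadius x ^ (m + 2) * |η x| ^ (m + 3) := by
    have ig : Integrable fun x => |cylRadius x * η x| * |η x| := by
      refine iGη.abs.congr (ae_of_all _ fun x => ?_)
      beta_reduce
      exact abs_mul (cylRadius x * η x) (η x)
    have hc : Continuous fun x => |cylRadius x * η x| ^ (m + 1) :=
      (continuous_abs.comp (hrc.mul hηc)).pow (m + 1)
    refine (integrable_bdd_mul (L ^ (m + 1)) hc
      (fun x => by rw [abs_pow, abs_abs]; exact abs_cylRadius_mul_pow_le hLτ (m + 1) x) ig).congr
      (ae_of_all _ fun x => ?_)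
    beta_reduce
    rw [abs_mul (cylRadius x) (η x), abs_of_nonneg (hr0 x)]
    ring
  -- `X₂ = r^{2m+5} η^{2m+6} = (rη)^{2m+4} · (rη · η)`
  have iX₂ : Integrable fun x => cylRadius x ^ (2 * m + 5) * η x ^ (2 * m + 6) := by
    have hc : Continuous fun x => (cylRadius x * η x) ^ (2 * m + 4) := (hrc.mul hηc).pow (2 * m + 4)
    refine (integrable_bdd_mul (L ^ (2 * m + 4)) hc
      (fun x => by rw [abs_pow]; exact abs_cylRadius_mul_pow_le hLτ _ x) iGη).congr
      (ae_of_all _ fun x => ?_)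
    beta_reduce; ring
  -- the dissipation pieces
  have iA : Integrable fun x => cylRadius x ^ (2 * m + 3) * η x ^ (2 * m + 6) := by
    have hc : Continuous fun x => (cylRadius x * η x) ^ (2 * m + 2) * (η x * η x) :=
      ((hrc.mul hηc).pow _).mul (hηc.mul hηc)
    refine (integrable_bdd_mul (L ^ (2 * m + 2) * (F * F)) hc (fun x => ?_) iGη).congr
      (ae_of_all _ fun x => ?_)
    · rw [abs_mul ((cylRadius x * η x) ^ (2 * m + 2)) (η x * η x), abs_pow, abs_mul (η x) (η x)]
      exact mul_le_mul (abs_cylRadius_mul_pow_le hLτ _ x) (mul_le_mul (hFτ x) (hFτ x) (abs_nonneg _) hF0)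
        (by positivity) (pow_nonneg hL0 _)
    · beta_reduce; ring
  have iM : Integrable fun x => 2 * cylRadius x ^ (2 * m + 5) * η x ^ (2 * m + 5) * radDerivQuot η x := by
    have hc : Continuous fun x => 2 * (cylRadius x * η x) ^ (2 * m + 4) :=
      continuous_const.mul ((hrc.mul hηc).pow (2 * m + 4))
    refine (integrable_bdd_mul (2 * L ^ (2 * m + 4)) hc (fun x => ?_) iGq).congr (ae_of_all _ fun x => ?_)
    · rw [abs_mul (2 : ℝ), abs_two, abs_pow]
      exact mul_le_mul_of_nonneg_left (abs_cylRadius_mul_pow_le hLτ _ x) zero_le_two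
    · beta_reduce; ring
  have hnsq : ∀ x, ‖fderiv ℝ η x‖ ^ 2 =
      fderiv ℝ η x (EuclideanSpace.single 0 1) * fderiv ℝ η x (EuclideanSpace.single 0 1) +
      fderiv ℝ η x (EuclideanSpace.single 1 1) * fderiv ℝ η x (EuclideanSpace.single 1 1) +
      fderiv ℝ η x (EuclideanSpace.single 2 1) * fderiv ℝ η x (EuclideanSpace.single 2 1) := by
    intro x
    rw [norm_sq_eq_sum_sq_single' (fderiv ℝ η x), Fin.sum_univ_three]
    ring
  have iDi : ∀ i : Fin 3, Integrable fun x => cylRadius x ^ (2 * m + 5) * η x ^ (2 * m + 4) *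
      (fderiv ℝ η x (EuclideanSpace.single i 1) * fderiv ℝ η x (EuclideanSpace.single i 1)) := by
    intro i
    have hc : Continuous fun x => (cylRadius x * η x) ^ (2 * m + 3) * η x := ((hrc.mul hηc).pow _).mul hηc
    refine (integrable_bdd_mul (L ^ (2 * m + 3) * F) hc (fun x => ?_) (iRD i)).congr
      (ae_of_all _ fun x => ?_)
    · rw [abs_mul ((cylRadius x * η x) ^ (2 * m + 3)) (η x), abs_pow]
      exact mul_le_mul (abs_cylRadius_mul_pow_le hLτ _ x) (hFτ x) (abs_nonneg _) (pow_nonneg hL0 _)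
    · beta_reduce; ring
  have iD : Integrable fun x => cylRadius x ^ (2 * m + 5) * η x ^ (2 * m + 4) * ‖fderiv ℝ η x‖ ^ 2 := by
    have i01 : Integrable fun x => cylRadius x ^ (2 * m + 5) * η x ^ (2 * m + 4) *
        (fderiv ℝ η x (EuclideanSpace.single 0 1) * fderiv ℝ η x (EuclideanSpace.single 0 1)) +
        cylRadius x ^ (2 * m + 5) * η x ^ (2 * m + 4) *
        (fderiv ℝ η x (EuclideanSpace.single 1 1) * fderiv ℝ η x (EuclideanSpace.single 1 1)) :=
      (iDi 0).add (iDi 1)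
    refine (i01.add (iDi 2)).congr (ae_of_all _ fun x => ?_)
    simp only [Pi.add_apply, hnsq x]; ring
  have iX : Integrable fun x => cylRadius x ^ (2 * m + 3) * η x ^ (2 * m + 6) +
      2 * cylRadius x ^ (2 * m + 5) * η x ^ (2 * m + 5) * radDerivQuot η x +
      cylRadius x ^ (2 * m + 5) * η x ^ (2 * m + 4) * ‖fderiv ℝ η x‖ ^ 2 := by
    have i1 : Integrable fun x => cylRadius x ^ (2 * m + 3) * η x ^ (2 * m + 6) +
        2 * cylRadius x ^ (2 * m + 5) * η x ^ (2 * m + 5) * radDerivQuot η x := iA.add iM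
    exact i1.add iD
  -- pointwise nonnegativity of the dissipation density (`r k² X = ‖D(r^k η^k)‖² ≥ 0`)
  have hXnn : ∀ x, 0 ≤ cylRadius x ^ (2 * m + 3) * η x ^ (2 * m + 6) +
      2 * cylRadius x ^ (2 * m + 5) * η x ^ (2 * m + 5) * radDerivQuot η x +
      cylRadius x ^ (2 * m + 5) * η x ^ (2 * m + 4) * ‖fderiv ℝ η x‖ ^ 2 := by
    intro x
    have hid := cylRadius_mul_sq_mul_dissipDensity_eq_norm_fderiv_sq (k := m + 3) (by omega) hη2 hηax x
    simp only [n1, n2, n3] at hid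
    simp only [n0] at hid
    push_cast at hid
    rcases (hr0 x).eq_or_lt with hr | hr
    · rw [← hr]; simp
    · have hk2 : (0 : ℝ) < ((m : ℝ) + 3) ^ 2 := by positivity
      have h0 : 0 ≤ cylRadius x * (((m : ℝ) + 3) ^ 2 * (cylRadius x ^ (2 * m + 3) * η x ^ (2 * m + 6) +
          2 * cylRadius x ^ (2 * m + 5) * η x ^ (2 * m + 5) * radDerivQuot η x +
          cylRadius x ^ (2 * m + 5) * η x ^ (2 * m + 4) * ‖fderiv ℝ η x‖ ^ 2)) := by
        rw [hid]; exact sq_nonneg _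
      have h1 := (mul_nonneg_iff_of_pos_left hr).1 h0
      exact (mul_nonneg_iff_of_pos_left hk2).1 h1
  refine ⟨?_, iX₂, iX₁, integral_nonneg hXnn⟩
  -- Nash on `Ω`
  set XD : EuclideanSpace ℝ (Fin 3) → ℝ := fun x => ((m : ℝ) + 3) ^ 2 *
    (cylRadius x ^ (2 * m + 3) * η x ^ (2 * m + 6) +
      2 * cylRadius x ^ (2 * m + 5) * η x ^ (2 * m + 5) * radDerivQuot η x +
      cylRadius x ^ (2 * m + 5) * η x ^ (2 * m + 4) * ‖fderiv ℝ η x‖ ^ 2) with hXD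
  have hh : ContDiff ℝ 1 fun y : EuclideanSpace ℝ (Fin 3) => cylRadius y ^ (m + 3) * η y ^ (m + 3) :=
    contDiff_one_cylRadius_pow_mul_pow (by omega) hη1
  have hhax : IsAxisymmetricScalar fun y : EuclideanSpace ℝ (Fin 3) => cylRadius y ^ (m + 3) * η y ^ (m + 3) :=
    fun θ x => by simp only [cylRadius_rotZ, hηax θ x]
  have hX₁a : IsAxisymmetricScalar fun x => cylRadius x ^ (m + 2) * |η x| ^ (m + 3) :=
    fun θ x => by simp only [cylRadius_rotZ, hηax θ x]
  have hX₂a : IsAxisymmetricScalar fun x => cylRadius x ^ (2 * m + 5) * η x ^ (2 * m + 6) :=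
    fun θ x => by simp only [cylRadius_rotZ, hηax θ x]
  have hXDa : IsAxisymmetricScalar XD := fun θ x => by
    simp only [hXD, cylRadius_rotZ, hηax θ x, hqax θ x, hDax θ x]
  have hX₁c : Continuous fun x => cylRadius x ^ (m + 2) * |η x| ^ (m + 3) :=
    (hrc.pow _).mul ((continuous_abs.comp hηc).pow _)
  have hX₂c : Continuous fun x => cylRadius x ^ (2 * m + 5) * η x ^ (2 * m + 6) :=
    (hrc.pow _).mul (hηc.pow _)
  have hXDc : Continuous XD :=
    continuous_const.mul ((((hrc.pow _).mul (hηc.pow _)).add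
      (((continuous_const.mul (hrc.pow _)).mul (hηc.pow _)).mul hqc)).add
      (((hrc.pow _).mul (hηc.pow _)).mul (hDc.pow 2)))
  have hXDi : Integrable XD := iX.const_mul _
  have h1 : ∀ x, cylRadius x * (cylRadius x ^ (m + 2) * |η x| ^ (m + 3)) =
      |cylRadius x ^ (m + 3) * η x ^ (m + 3)| := fun x => by
    rw [abs_mul, abs_pow, abs_pow, abs_of_nonneg (hr0 x)]; ring
  have h2 : ∀ x, cylRadius x * (cylRadius x ^ (2 * m + 5) * η x ^ (2 * m + 6)) =
      (cylRadius x ^ (m + 3) * η x ^ (m + 3)) ^ 2 := fun x => by ring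
  have hD : ∀ x, cylRadius x * XD x = ‖fderiv ℝ (fun y => cylRadius y ^ (m + 3) * η y ^ (m + 3)) x‖ ^ 2 := by
    intro x
    have := cylRadius_mul_sq_mul_dissipDensity_eq_norm_fderiv_sq (k := m + 3) (by omega) hη2 hηax x
    simp only [n1, n2, n3] at this
    simp only [n0] at this
    push_cast at this
    simpa only [hXD] using this
  have hN := sq_integral_le_nash_halfPlane hh hhax hX₁a hX₁c iX₁ hX₂a hX₂c iX₂ hXDa hXDc hXDi h1 h2 hD
  have hXDint : ∫ x, XD x = ((m : ℝ) + 3) ^ 2 * ∫ x, (cylRadius x ^ (2 * m + 3) * η x ^ (2 * m + 6) +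
      2 * cylRadius x ^ (2 * m + 5) * η x ^ (2 * m + 5) * radDerivQuot η x +
      cylRadius x ^ (2 * m + 5) * η x ^ (2 * m + 4) * ‖fderiv ℝ η x‖ ^ 2) := by
    rw [hXD, integral_const_mul]
  rw [hXDint] at hN
  exact hN

/-- **Hölder for the base step `k = 3`**: `∫ r²|η|³ ≤ (∫|η|)^{3/5} (∫ r⁵η⁶)^{2/5}`
(`r²|η|³ = |η|^{3/5} · (r⁵η⁶)^{2/5}`, exponents `5/3`, `5/2`). [folklore] -/
private theorem holder_base {η : EuclideanSpace ℝ (Fin 3) → ℝ} (hηc : Continuous η) (hI1 : Integrable η)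
    (hI6 : Integrable fun x => cylRadius x ^ 5 * η x ^ 6) :
    ∫ x, cylRadius x ^ 2 * |η x| ^ 3 ≤
      (∫ x, |η x|) ^ (3 / 5 : ℝ) * (∫ x, cylRadius x ^ 5 * η x ^ 6) ^ (2 / 5 : ℝ) := by
  have hr0 : ∀ x : EuclideanSpace ℝ (Fin 3), 0 ≤ cylRadius x := cylRadius_nonneg
  set f : EuclideanSpace ℝ (Fin 3) → ℝ := fun x => |η x| ^ (3 / 5 : ℝ) with hf
  set g : EuclideanSpace ℝ (Fin 3) → ℝ := fun x => cylRadius x ^ 2 * |η x| ^ (12 / 5 : ℝ) with hg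
  have hf0 : ∀ x, 0 ≤ f x := fun x => Real.rpow_nonneg (abs_nonneg _) _
  have hg0 : ∀ x, 0 ≤ g x := fun x => mul_nonneg (sq_nonneg _) (Real.rpow_nonneg (abs_nonneg _) _)
  have hpq : Real.HolderConjugate (5 / 3 : ℝ) (5 / 2 : ℝ) := by
    rw [Real.holderConjugate_iff]; norm_num
  have hfc : Continuous f := (continuous_abs.comp hηc).rpow_const fun _ => Or.inr (by norm_num)
  have hgc : Continuous g :=
    (continuous_cylRadius.pow 2).mul ((continuous_abs.comp hηc).rpow_const fun _ => Or.inr (by norm_num))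
  -- `f^{5/3} = |η|`, `g^{5/2} = r⁵ η⁶`, `f g = r² |η|³`
  have hfp : ∀ x, f x ^ (5 / 3 : ℝ) = |η x| := fun x => by
    simp only [hf]
    rw [← Real.rpow_mul (abs_nonneg _), show (3 / 5 : ℝ) * (5 / 3) = 1 by norm_num, Real.rpow_one]
  have hgq : ∀ x, g x ^ (5 / 2 : ℝ) = cylRadius x ^ 5 * η x ^ 6 := fun x => by
    have h1 : (cylRadius x ^ 2) ^ (5 / 2 : ℝ) = cylRadius x ^ 5 := by
      rw [← Real.rpow_natCast (cylRadius x) 2, ← Real.rpow_mul (hr0 x),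
        show ((2 : ℕ) : ℝ) * (5 / 2) = ((5 : ℕ) : ℝ) by norm_num, Real.rpow_natCast]
    have h2 : (|η x| ^ (12 / 5 : ℝ)) ^ (5 / 2 : ℝ) = η x ^ 6 := by
      rw [← Real.rpow_mul (abs_nonneg _), show (12 / 5 : ℝ) * (5 / 2) = ((6 : ℕ) : ℝ) by norm_num,
        Real.rpow_natCast]
      exact (show Even 6 from ⟨3, rfl⟩).pow_abs (η x)
    simp only [hg]
    rw [Real.mul_rpow (sq_nonneg _) (Real.rpow_nonneg (abs_nonneg _) _), h1, h2]
  have hfg : ∀ x, f x * g x = cylRadius x ^ 2 * |η x| ^ 3 := fun x => by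
    have h3 : |η x| ^ (3 / 5 : ℝ) * |η x| ^ (12 / 5 : ℝ) = |η x| ^ 3 := by
      rw [← Real.rpow_add' (abs_nonneg _) (by norm_num),
        show (3 / 5 : ℝ) + 12 / 5 = ((3 : ℕ) : ℝ) by norm_num, Real.rpow_natCast]
    simp only [hf, hg]
    calc |η x| ^ (3 / 5 : ℝ) * (cylRadius x ^ 2 * |η x| ^ (12 / 5 : ℝ))
        = cylRadius x ^ 2 * (|η x| ^ (3 / 5 : ℝ) * |η x| ^ (12 / 5 : ℝ)) := by ring
      _ = cylRadius x ^ 2 * |η x| ^ 3 := by rw [h3]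
  -- membership in `L^{5/3}`, `L^{5/2}`
  have hfLp : MemLp f (ENNReal.ofReal (5 / 3)) volume := by
    refine (MeasureTheory.integrable_norm_rpow_iff hfc.aestronglyMeasurable
      (by norm_num) ENNReal.ofReal_ne_top).1 ?_
    refine hI1.abs.congr (ae_of_all _ fun x => ?_)
    rw [ENNReal.toReal_ofReal (by norm_num)]
    beta_reduce
    rw [Real.norm_of_nonneg (hf0 x), hfp x]
  have hgLp : MemLp g (ENNReal.ofReal (5 / 2)) volume := by
    refine (MeasureTheory.integrable_norm_rpow_iff hgc.aestronglyMeasurable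
      (by norm_num) ENNReal.ofReal_ne_top).1 ?_
    refine hI6.congr (ae_of_all _ fun x => ?_)
    rw [ENNReal.toReal_ofReal (by norm_num)]
    beta_reduce
    rw [Real.norm_of_nonneg (hg0 x), hgq x]
  have hH := integral_mul_le_Lp_mul_Lq_of_nonneg hpq (ae_of_all _ hf0) (ae_of_all _ hg0) hfLp hgLp
  simp only [hfg, hfp, hgq] at hH
  norm_num at hH
  exact hH

/-! ### The two Bernoulli slices: pure algebra -/

section Algebra

open Real

/-- The algebra of the doubling step: Nash + the induction hypothesis turn the slice inequality
into the Bernoulli form `σ ≤ −a τ^{2k−2} F² + (α/τ)F`. [folklore] -/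
private theorem alg_step {F Fj X σ C B τ ν w : ℝ} {j k : ℕ} (hj : 1 ≤ j) (hk : k = 2 * j)
    (hC : 0 < C) (hB : 0 < B) (hτ : 0 < τ) (hν : 0 < ν) (hX : 0 ≤ X) (hFj0 : 0 ≤ Fj)
    (hFj : Fj ≤ B * τ ^ (-(2 * (j : ℝ) - 1)))
    (hN : F ^ 2 ≤ C * Fj ^ 2 * ((k : ℝ) ^ 2 * X))
    (hS : σ + ν * (2 * (2 * k - 1) * k) * X ≤ (2 * k - 1) * (w * τ⁻¹) * F) :
    σ ≤ -(2 * ν * (2 * k - 1) / (C * B ^ 2 * k)) * τ ^ (2 * (k : ℝ) - 2) * F ^ (1 + (1 : ℝ)) +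
      (2 * k - 1) * w / τ * F := by
  have hj1 : (1 : ℝ) ≤ j := by exact_mod_cast hj
  have hkj : (k : ℝ) = 2 * j := by rw [hk]; push_cast; ring
  have hk0 : (0 : ℝ) < k := by rw [hkj]; linarith
  -- `Fj² ≤ B² τ^{-(2k-2)}`
  have hτe2 : (τ ^ (-(2 * (j : ℝ) - 1))) ^ 2 = τ ^ (-(2 * (k : ℝ) - 2)) := by
    rw [← rpow_natCast, ← rpow_mul hτ.le]
    congr 1
    rw [hkj]; push_cast; ring
  have h1 : Fj ^ 2 ≤ B ^ 2 * τ ^ (-(2 * (k : ℝ) - 2)) := by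
    have := pow_le_pow_left₀ hFj0 hFj 2
    rwa [mul_pow, hτe2] at this
  -- `F² τ^{2k-2} ≤ C B² k² X`
  have h2 : F ^ 2 * τ ^ (2 * (k : ℝ) - 2) ≤ C * B ^ 2 * (k : ℝ) ^ 2 * X := by
    have hτm : 0 < τ ^ (2 * (k : ℝ) - 2) := rpow_pos_of_pos hτ _
    have h3 : F ^ 2 ≤ C * (B ^ 2 * τ ^ (-(2 * (k : ℝ) - 2))) * ((k : ℝ) ^ 2 * X) := by
      refine hN.trans ?_
      have hkX : 0 ≤ (k : ℝ) ^ 2 * X := by positivity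
      exact mul_le_mul_of_nonneg_right (mul_le_mul_of_nonneg_left h1 hC.le) hkX
    have hcancel : τ ^ (-(2 * (k : ℝ) - 2)) * τ ^ (2 * (k : ℝ) - 2) = 1 := by
      rw [← rpow_add hτ]; simp
    calc F ^ 2 * τ ^ (2 * (k : ℝ) - 2)
        ≤ C * (B ^ 2 * τ ^ (-(2 * (k : ℝ) - 2))) * ((k : ℝ) ^ 2 * X) * τ ^ (2 * (k : ℝ) - 2) :=
          mul_le_mul_of_nonneg_right h3 hτm.le
      _ = C * B ^ 2 * (k : ℝ) ^ 2 * X * (τ ^ (-(2 * (k : ℝ) - 2)) * τ ^ (2 * (k : ℝ) - 2)) := by ring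
      _ = C * B ^ 2 * (k : ℝ) ^ 2 * X := by rw [hcancel, mul_one]
  -- the dissipation dominates
  have h4 : 2 * ν * (2 * k - 1) / (C * B ^ 2 * k) * τ ^ (2 * (k : ℝ) - 2) * F ^ (1 + (1 : ℝ)) ≤
      ν * (2 * (2 * k - 1) * k) * X := by
    have hF2 : F ^ (1 + (1 : ℝ)) = F ^ 2 := by norm_num
    rw [hF2]
    have hpos : 0 ≤ 2 * ν * (2 * (k : ℝ) - 1) / (C * B ^ 2 * k) := by
      have hk1 : (1 : ℝ) ≤ k := by rw [hkj]; linarith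
      exact div_nonneg (by nlinarith) (by positivity)
    calc 2 * ν * (2 * k - 1) / (C * B ^ 2 * k) * τ ^ (2 * (k : ℝ) - 2) * F ^ 2
        = 2 * ν * (2 * k - 1) / (C * B ^ 2 * k) * (F ^ 2 * τ ^ (2 * (k : ℝ) - 2)) := by ring
      _ ≤ 2 * ν * (2 * k - 1) / (C * B ^ 2 * k) * (C * B ^ 2 * (k : ℝ) ^ 2 * X) :=
          mul_le_mul_of_nonneg_left h2 hpos
      _ = ν * (2 * (2 * k - 1) * k) * X := by
          field_simp
  have h5 : (2 * k - 1) * (w * τ⁻¹) * F = (2 * k - 1) * w / τ * F := by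
    rw [div_eq_mul_inv]; ring
  linarith [hS, h4, h5]

/-- The algebra of the base step `k = 3`: Nash + Hölder turn the slice inequality into the
Bernoulli form `σ ≤ −a F^{6/5} + (α/τ)F`. [folklore] -/
private theorem alg_base {F I₁ A₁ A X σ C τ ν w : ℝ}
    (hC : 0 < C) (hA : 0 < A) (hν : 0 < ν) (hX : 0 ≤ X) (hF0 : 0 ≤ F)
    (hI₁0 : 0 ≤ I₁) (hA₁0 : 0 ≤ A₁) (hA₁ : A₁ ≤ A)
    (hH : I₁ ≤ A₁ ^ (3 / 5 : ℝ) * F ^ (2 / 5 : ℝ))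
    (hN : F ^ 2 ≤ C * I₁ ^ 2 * ((3 : ℝ) ^ 2 * X))
    (hS : σ + ν * (2 * (2 * 3 - 1) * 3) * X ≤ (2 * 3 - 1) * (w * τ⁻¹) * F) :
    σ ≤ -(10 * ν / (3 * C * A ^ (6 / 5 : ℝ))) * τ ^ (0 : ℝ) * F ^ (1 + (1 / 5 : ℝ)) +
      5 * w / τ * F := by
  rw [rpow_zero, mul_one]
  -- `I₁² ≤ A^{6/5} F^{4/5}`
  have hA65 : 0 < A ^ (6 / 5 : ℝ) := rpow_pos_of_pos hA _
  have h1 : I₁ ^ 2 ≤ A ^ (6 / 5 : ℝ) * F ^ (4 / 5 : ℝ) := by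
    have hI : I₁ ≤ A ^ (3 / 5 : ℝ) * F ^ (2 / 5 : ℝ) :=
      hH.trans (mul_le_mul_of_nonneg_right (rpow_le_rpow hA₁0 hA₁ (by norm_num)) (rpow_nonneg hF0 _))
    have e1 : (A ^ (3 / 5 : ℝ)) ^ 2 = A ^ (6 / 5 : ℝ) := by
      rw [← rpow_natCast, ← rpow_mul hA.le]; norm_num
    have e2 : (F ^ (2 / 5 : ℝ)) ^ 2 = F ^ (4 / 5 : ℝ) := by
      rw [← rpow_natCast, ← rpow_mul hF0]; norm_num
    have := pow_le_pow_left₀ hI₁0 hI 2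
    rwa [mul_pow, e1, e2] at this
  -- `F² ≤ 9 C A^{6/5} F^{4/5} X`
  have h2 : F ^ 2 ≤ 9 * C * A ^ (6 / 5 : ℝ) * F ^ (4 / 5 : ℝ) * X := by
    refine hN.trans ?_
    have h9X : 0 ≤ (3 : ℝ) ^ 2 * X := by positivity
    calc C * I₁ ^ 2 * ((3 : ℝ) ^ 2 * X) ≤ C * (A ^ (6 / 5 : ℝ) * F ^ (4 / 5 : ℝ)) * ((3 : ℝ) ^ 2 * X) :=
          mul_le_mul_of_nonneg_right (mul_le_mul_of_nonneg_left h1 hC.le) h9X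
      _ = 9 * C * A ^ (6 / 5 : ℝ) * F ^ (4 / 5 : ℝ) * X := by ring
  -- `F^{6/5} ≤ 9 C A^{6/5} X`
  have h3 : F ^ (1 + (1 / 5 : ℝ)) ≤ 9 * C * A ^ (6 / 5 : ℝ) * X := by
    have h65 : (1 + (1 / 5 : ℝ)) = 6 / 5 := by norm_num
    rw [h65]
    rcases hF0.eq_or_lt with hF | hF
    · rw [← hF, zero_rpow (by norm_num)]
      positivity
    · have hF45 : 0 < F ^ (4 / 5 : ℝ) := rpow_pos_of_pos hF _
      have hsplit : F ^ 2 = F ^ (6 / 5 : ℝ) * F ^ (4 / 5 : ℝ) := by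
        rw [← rpow_add hF, ← rpow_natCast F 2]; norm_num
      rw [hsplit] at h2
      have : F ^ (6 / 5 : ℝ) * F ^ (4 / 5 : ℝ) ≤ (9 * C * A ^ (6 / 5 : ℝ) * X) * F ^ (4 / 5 : ℝ) := by
        calc F ^ (6 / 5 : ℝ) * F ^ (4 / 5 : ℝ) ≤ 9 * C * A ^ (6 / 5 : ℝ) * F ^ (4 / 5 : ℝ) * X := h2
          _ = (9 * C * A ^ (6 / 5 : ℝ) * X) * F ^ (4 / 5 : ℝ) := by ring
      exact le_of_mul_le_mul_right this hF45
  -- the dissipation dominates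
  have h4 : 10 * ν / (3 * C * A ^ (6 / 5 : ℝ)) * F ^ (1 + (1 / 5 : ℝ)) ≤ ν * (2 * (2 * 3 - 1) * 3) * X := by
    calc 10 * ν / (3 * C * A ^ (6 / 5 : ℝ)) * F ^ (1 + (1 / 5 : ℝ))
        ≤ 10 * ν / (3 * C * A ^ (6 / 5 : ℝ)) * (9 * C * A ^ (6 / 5 : ℝ) * X) :=
          mul_le_mul_of_nonneg_left h3 (by positivity)
      _ = ν * (2 * (2 * 3 - 1) * 3) * X := by
          field_simp
          ring
  have h5 : (2 * 3 - 1) * (w * τ⁻¹) * F = 5 * w / τ * F := by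
    rw [div_eq_mul_inv]; ring
  linarith [hS, h4, h5]

end Algebra

/-! ### The base step `k = 3` and the doubling step `k ↦ 2k` -/

/-- **The doubling step `j ↦ k = 2j`** (`j ≥ 3`): if `F_j(τ) ≤ B τ^{−(2j−1)}` on `(0, T]` then
`F_k(t) ≤ C⁺ j (1+w) B²/ν · t^{−(2k−1)}` on `(0, T]`, where `u_r/r ≤ w/τ` is the transport bound,
`C⁺ = max(C_N, 1)` — Gallay–Šverák's (5.8)–(5.10) for the exponent `p = 2k` with Nash's inequality
on `Ω` (`‖ω_θ^k‖_{L¹(Ω)} = F_{k/2}`) and the integrated Bernoulli inequality (Feng–Šverák's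
`p ↦ 2p` device). [cite: GallaySverak2016, proof of Prop. 5.3 (5.8)–(5.10) (arXiv pp. 16–17);
FengSverak2015, proof of Lemma 3.8, induction step (arXiv p. 12)] -/
private theorem step (h : IsTaoSolutionOn T ν u₀ v q) (hT : 0 < T) (hν : 0 < ν)
    (hax : ∀ t ∈ Icc 0 T, IsAxisymmetric (v t)) (hsw : ∀ t ∈ Icc 0 T, HasNoSwirl (v t))
    {w : ℝ} (hw : 0 ≤ w) (hW : ∀ τ ∈ Ioc 0 T, ∀ x, radVelQuot (v τ) x ≤ w * τ⁻¹)
    {j k : ℕ} (hj : 3 ≤ j) (hk : k = 2 * j) {B : ℝ} (hB : 0 < B)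
    (hyp : ∀ τ ∈ Ioc 0 T, ∫ x, cylRadius x ^ (2 * j - 1) * angVortQuot (v τ) x ^ (2 * j) ≤
      B * τ ^ (-(2 * (j : ℝ) - 1))) {t : ℝ} (ht : t ∈ Ioc 0 T) :
    ∫ x, cylRadius x ^ (2 * k - 1) * angVortQuot (v t) x ^ (2 * k) ≤
      max (32 * (lintegralPowLePowLIntegralFDerivConst (volume : Measure (EuclideanSpace ℝ (Fin 2))) 2 : ℝ) /
        radialConst₂) 1 * j * (1 + w) / ν * B ^ 2 * t ^ (-(2 * (k : ℝ) - 1)) := by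
  set Cp : ℝ := max (32 * (lintegralPowLePowLIntegralFDerivConst
    (volume : Measure (EuclideanSpace ℝ (Fin 2))) 2 : ℝ) / radialConst₂) 1 with hCp
  have hCp1 : 1 ≤ Cp := le_max_right _ _
  have hCp0 : 0 < Cp := one_pos.trans_le hCp1
  have hk3 : 3 ≤ k := by omega
  have hj1 : 1 ≤ j := by omega
  have hkj : (k : ℝ) = 2 * j := by rw [hk]; push_cast; ring
  have hk1 : (1 : ℝ) ≤ k := by exact_mod_cast (show 1 ≤ k by omega)
  -- the balance and the continuity of `F_k`
  obtain ⟨hσI, hFc, hbal⟩ := h.integral_weight_pow_angVortQuot_balance hT hax hk3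
  have hσI' := (integrableOn_Icc_iff_integrableOn_Ioo (μ := volume)).2 hσI
  -- the Bernoulli data
  set a : ℝ := 2 * ν * (2 * k - 1) / (Cp * B ^ 2 * k) with ha
  have ha0 : 0 < a := by
    rw [ha]; exact div_pos (by nlinarith) (by positivity)
  have hm : (0 : ℝ) ≤ 2 * (k : ℝ) - 2 := by linarith
  have hα : 0 ≤ (2 * (k : ℝ) - 1) * w := by nlinarith
  have hODE := le_mul_rpow_of_sub_eq_integral_of_slice_le (T := T)
    (F := fun τ => ∫ x, cylRadius x ^ (2 * k - 1) * angVortQuot (v τ) x ^ (2 * k))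
    (σ := fun τ => ∫ x, 2 * k * cylRadius x ^ (2 * k - 1) * angVortQuot (v τ) x ^ (2 * k - 1) *
      angVortQuot (timeDerivWithin (Icc 0 T) v τ) x)
    (m := 2 * (k : ℝ) - 2) (γ := 1) (α := (2 * (k : ℝ) - 1) * w) ha0 hm one_pos hα hFc
    (fun s t' hs hst ht' => (hσI'.mono_set (by
      rw [uIcc_of_le hst]; exact Icc_subset_Icc hs.le ht')).intervalIntegrable)
    (fun s t' hs hst ht' => hbal s t' hs.le hst ht') ?_ t ht
  · refine hODE.trans_eq ?_
    have e1 : (1 / (1 : ℝ)) = 1 := by norm_num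
    have e2 : -(2 * (k : ℝ) - 2 + 1) / (1 : ℝ) = -(2 * (k : ℝ) - 1) := by ring
    rw [e1, Real.rpow_one, e2]
    congr 1
    rw [ha, mul_one, mul_one]
    have h2k : (2 * (k : ℝ) - 1) ≠ 0 := by linarith
    have hkne : (k : ℝ) ≠ 0 := by linarith
    have hνne : ν ≠ 0 := hν.ne'
    have hCne : Cp ≠ 0 := hCp0.ne'
    have hBne : B ≠ 0 := hB.ne'
    rw [div_div_eq_mul_div]
    field_simp
    rw [hkj]
    ring
  -- the slice inequality in Bernoulli form
  intro τ hτ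
  have hτI : τ ∈ Icc 0 T := Ioo_subset_Icc_self hτ
  have hτ' : τ ∈ Ioc 0 T := ⟨hτ.1, hτ.2.le⟩
  have hS := h.integral_weight_pow_mul_angVortQuot_deriv_add_dissipation_le hT hν.le hax hsw hk3 hτI
    (hW τ hτ')
  obtain ⟨hN, -, -, hX0⟩ := nash_slice h hax hk3 hτI
  -- `∫ r^{k−1} |η|^k = F_j(τ)`
  have hX₁ : ∫ x, cylRadius x ^ (k - 1) * |angVortQuot (v τ) x| ^ k =
      ∫ x, cylRadius x ^ (2 * j - 1) * angVortQuot (v τ) x ^ (2 * j) := by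
    refine integral_congr_ae (ae_of_all _ fun x => ?_)
    beta_reduce
    rw [show k - 1 = 2 * j - 1 by omega, hk, (even_two_mul j).pow_abs]
  rw [hX₁] at hN
  have hFj0 : 0 ≤ ∫ x, cylRadius x ^ (2 * j - 1) * angVortQuot (v τ) x ^ (2 * j) :=
    integral_nonneg fun x => mul_nonneg (pow_nonneg (cylRadius_nonneg x) _) ((even_two_mul j).pow_nonneg _)
  have hN' := hN.trans (mul_le_mul_of_nonneg_right
    (mul_le_mul_of_nonneg_right (le_max_left _ 1) (sq_nonneg _)) (by positivity))
  exact alg_step hj1 hk hCp0 hB hτ.1 hν hX0 hFj0 (hyp τ hτ') hN' hS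

/-- **The base step `k = 3`**: `F_3(t) = ∫ r⁵η⁶ ≤ (3C⁺(1+w)/(2ν))⁵ A⁶ t^{−5}` on `(0, T]`,
`A = ∫|η(0)|` — (5.8)–(5.10) for `p = 6` with Nash on `Ω`, Hölder
`‖ω_θ³‖_{L¹(Ω)} ≤ ‖η‖₁^{3/5}‖ω_θ‖_{L⁶(Ω)}^{12/5}` and Lemma 5.1 (`‖η(τ)‖₁ ≤ A`), and the
integrated Bernoulli inequality with `γ = 1/5`. [cite: GallaySverak2016, proof of Prop. 5.3
(5.8)–(5.10) and Lemma 5.1 (arXiv pp. 16–17)] -/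
private theorem base (h : IsTaoSolutionOn T ν u₀ v q) (hT : 0 < T) (hν : 0 < ν)
    (hax : ∀ t ∈ Icc 0 T, IsAxisymmetric (v t)) (hsw : ∀ t ∈ Icc 0 T, HasNoSwirl (v t))
    (hL1 : Integrable (angVortQuot (v 0))) (hA : 0 < ∫ x, |angVortQuot (v 0) x|)
    {w : ℝ} (hw : 0 ≤ w) (hW : ∀ τ ∈ Ioc 0 T, ∀ x, radVelQuot (v τ) x ≤ w * τ⁻¹)
    {t : ℝ} (ht : t ∈ Ioc 0 T) :
    ∫ x, cylRadius x ^ (2 * 3 - 1) * angVortQuot (v t) x ^ (2 * 3) ≤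
      (3 * max (32 * (lintegralPowLePowLIntegralFDerivConst (volume : Measure (EuclideanSpace ℝ (Fin 2))) 2 : ℝ) /
        radialConst₂) 1 * (1 + w) / (2 * ν)) ^ 5 * (∫ x, |angVortQuot (v 0) x|) ^ 6 *
        t ^ (-(2 * ((3 : ℕ) : ℝ) - 1)) := by
  set Cp : ℝ := max (32 * (lintegralPowLePowLIntegralFDerivConst
    (volume : Measure (EuclideanSpace ℝ (Fin 2))) 2 : ℝ) / radialConst₂) 1 with hCp
  set A : ℝ := ∫ x, |angVortQuot (v 0) x| with hAdef
  have hCp1 : 1 ≤ Cp := le_max_right _ _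
  have hCp0 : 0 < Cp := one_pos.trans_le hCp1
  have hA65 : 0 < A ^ (6 / 5 : ℝ) := Real.rpow_pos_of_pos hA _
  obtain ⟨hσI, hFc, hbal⟩ := h.integral_weight_pow_angVortQuot_balance hT hax (le_refl 3)
  have hσI' := (integrableOn_Icc_iff_integrableOn_Ioo (μ := volume)).2 hσI
  set a : ℝ := 10 * ν / (3 * Cp * A ^ (6 / 5 : ℝ)) with ha
  have ha0 : 0 < a := by rw [ha]; positivity
  have hα : (0 : ℝ) ≤ 5 * w := by positivity
  have hODE := le_mul_rpow_of_sub_eq_integral_of_slice_le (T := T)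
    (F := fun τ => ∫ x, cylRadius x ^ (2 * 3 - 1) * angVortQuot (v τ) x ^ (2 * 3))
    (σ := fun τ => ∫ x, 2 * (3 : ℕ) * cylRadius x ^ (2 * 3 - 1) * angVortQuot (v τ) x ^ (2 * 3 - 1) *
      angVortQuot (timeDerivWithin (Icc 0 T) v τ) x)
    (m := 0) (γ := 1 / 5) (α := 5 * w) ha0 le_rfl (by norm_num) hα hFc
    (fun s t' hs hst ht' => (hσI'.mono_set (by
      rw [uIcc_of_le hst]; exact Icc_subset_Icc hs.le ht')).intervalIntegrable)
    (fun s t' hs hst ht' => hbal s t' hs.le hst ht') ?_ t ht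
  · refine hODE.trans_eq ?_
    have e1 : (1 / (1 / 5 : ℝ)) = ((5 : ℕ) : ℝ) := by norm_num
    have e2 : -((0 : ℝ) + 1) / (1 / 5 : ℝ) = -(2 * ((3 : ℕ) : ℝ) - 1) := by norm_num
    rw [e1, Real.rpow_natCast, e2]
    congr 1
    have e3 : ((0 : ℝ) + 1 + 5 * w * (1 / 5)) / (a * (1 / 5)) = 3 * Cp * (1 + w) / (2 * ν) * A ^ (6 / 5 : ℝ) := by
      rw [ha]
      have hνne : ν ≠ 0 := hν.ne'
      have hCne : Cp ≠ 0 := hCp0.ne'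
      have hAne : A ^ (6 / 5 : ℝ) ≠ 0 := hA65.ne'
      field_simp
      ring
    rw [e3, mul_pow, ← Real.rpow_natCast (A ^ (6 / 5 : ℝ)) 5, ← Real.rpow_mul hA.le]
    norm_num
  -- the slice inequality in Bernoulli form
  intro τ hτ
  have hτI : τ ∈ Icc 0 T := Ioo_subset_Icc_self hτ
  have hτ' : τ ∈ Ioc 0 T := ⟨hτ.1, hτ.2.le⟩
  have hS := h.integral_weight_pow_mul_angVortQuot_deriv_add_dissipation_le hT hν.le hax hsw (le_refl 3)
    hτI (hW τ hτ')
  obtain ⟨hN, hI6, -, hX0⟩ := nash_slice h hax (le_refl 3) hτI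
  obtain ⟨hI1, hA₁⟩ := l1_slice h hT hν.le hax hsw hL1 hτI
  have hηc : Continuous (angVortQuot (v τ)) :=
    (contDiff_angVortQuot_of_contDiff (h.classical.contDiff_velocity hτI)).continuous
  have hH := holder_base hηc hI1 (by simpa using hI6)
  have hF0 : 0 ≤ ∫ x, cylRadius x ^ (2 * 3 - 1) * angVortQuot (v τ) x ^ (2 * 3) :=
    integral_nonneg fun x => mul_nonneg (pow_nonneg (cylRadius_nonneg x) _)
      ((show Even (2 * 3) by decide).pow_nonneg _)
  have hI₁0 : 0 ≤ ∫ x, cylRadius x ^ 2 * |angVortQuot (v τ) x| ^ 3 :=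
    integral_nonneg fun x => mul_nonneg (sq_nonneg _) (pow_nonneg (abs_nonneg _) _)
  have hA₁0 : 0 ≤ ∫ x, |angVortQuot (v τ) x| := integral_nonneg fun x => abs_nonneg _
  have hN' := hN.trans (mul_le_mul_of_nonneg_right
    (mul_le_mul_of_nonneg_right (le_max_left _ 1) (sq_nonneg _)) (by positivity))
  push_cast at hS hN' hH hF0 ⊢
  simp only [show (2 : ℕ) * 3 - 1 = 5 by norm_num, show (2 : ℕ) * 3 = 6 by norm_num,
    show (2 : ℕ) * 3 - 3 = 3 by norm_num, show (2 : ℕ) * 3 - 2 = 4 by norm_num] at hS hN' hH hF0 hX0 ⊢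
  exact alg_base hCp0 hA hν hX0 hF0 hI₁0 hA₁0 hA₁ hH hN' hS

/-! ### The iteration along `k = 3·2ⁿ` -/

/-- **The `L^{2k}(Ω)` bounds along `k = 3·2ⁿ`**: `F_{3·2ⁿ}(t) ≤ β_n t^{−(2·3·2ⁿ−1)}` with
`β_n = (6Dβ₀)^{2ⁿ}/(6D·2ⁿ)`, `D = C⁺(1+w)/ν`, `β₀ = (3C⁺(1+w)/(2ν))⁵A⁶` — the exact solution of
the recursion `β_{n+1} = D·(3·2ⁿ)·β_n²` of the doubling step (Feng–Šverák's "`C_p` is uniformly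
bounded from above", here for `ω_θ` on `Ω`). [cite: FengSverak2015, proof of Lemma 3.8, the bound for
`C_p` (arXiv p. 12); GallaySverak2016, proof of Prop. 5.3 (arXiv pp. 16–17)] -/
private theorem iterate (h : IsTaoSolutionOn T ν u₀ v q) (hT : 0 < T) (hν : 0 < ν)
    (hax : ∀ t ∈ Icc 0 T, IsAxisymmetric (v t)) (hsw : ∀ t ∈ Icc 0 T, HasNoSwirl (v t))
    (hL1 : Integrable (angVortQuot (v 0))) (hA : 0 < ∫ x, |angVortQuot (v 0) x|)
    {w : ℝ} (hw : 0 ≤ w) (hW : ∀ τ ∈ Ioc 0 T, ∀ x, radVelQuot (v τ) x ≤ w * τ⁻¹) (n : ℕ)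
    {t : ℝ} (ht : t ∈ Ioc 0 T) :
    ∫ x, cylRadius x ^ (2 * (3 * 2 ^ n) - 1) * angVortQuot (v t) x ^ (2 * (3 * 2 ^ n)) ≤
      (6 * (max (32 * (lintegralPowLePowLIntegralFDerivConst (volume : Measure (EuclideanSpace ℝ (Fin 2))) 2 : ℝ) /
          radialConst₂) 1 * (1 + w) / ν) *
        ((3 * max (32 * (lintegralPowLePowLIntegralFDerivConst (volume : Measure (EuclideanSpace ℝ (Fin 2))) 2 : ℝ) /
          radialConst₂) 1 * (1 + w) / (2 * ν)) ^ 5 * (∫ x, |angVortQuot (v 0) x|) ^ 6)) ^ (2 ^ n) /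
        (6 * (max (32 * (lintegralPowLePowLIntegralFDerivConst (volume : Measure (EuclideanSpace ℝ (Fin 2))) 2 : ℝ) /
          radialConst₂) 1 * (1 + w) / ν) * 2 ^ n) *
        t ^ (-(2 * ((3 * 2 ^ n : ℕ) : ℝ) - 1)) := by
  set Cp : ℝ := max (32 * (lintegralPowLePowLIntegralFDerivConst
    (volume : Measure (EuclideanSpace ℝ (Fin 2))) 2 : ℝ) / radialConst₂) 1 with hCp
  set A : ℝ := ∫ x, |angVortQuot (v 0) x| with hAdef
  set D : ℝ := Cp * (1 + w) / ν with hD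
  set β₀ : ℝ := (3 * Cp * (1 + w) / (2 * ν)) ^ 5 * A ^ 6 with hβ₀
  have hCp0 : 0 < Cp := one_pos.trans_le (le_max_right _ _)
  have hD0 : 0 < D := by rw [hD]; positivity
  have hβ₀0 : 0 < β₀ := by rw [hβ₀]; positivity
  induction n generalizing t with
  | zero =>
    have hb := base h hT hν hax hsw hL1 hA hw hW ht
    simp only [pow_zero, mul_one, pow_one]
    rw [show 6 * D * β₀ / (6 * D) = β₀ by field_simp]
    simpa only [pow_zero, mul_one] using hb
  | succ n ih =>
    set j : ℕ := 3 * 2 ^ n with hj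
    have hj3 : 3 ≤ j := by rw [hj]; exact Nat.le_mul_of_pos_right 3 (Nat.two_pow_pos n)
    have hk : 3 * 2 ^ (n + 1) = 2 * j := by rw [hj, pow_succ]; ring
    set B : ℝ := (6 * D * β₀) ^ (2 ^ n) / (6 * D * 2 ^ n) with hB
    have hB0 : 0 < B := by rw [hB]; positivity
    have hst := step h hT hν hax hsw hw hW hj3 hk hB0 (fun τ hτ => ih hτ) ht
    refine hst.trans_eq ?_
    congr 1
    rw [hB, hj]
    push_cast
    rw [pow_succ (2 : ℕ) n, pow_mul, pow_succ (2 : ℝ) n]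
    have h2n : (2 : ℝ) ^ n ≠ 0 := pow_ne_zero _ two_ne_zero
    have hDne : D ≠ 0 := hD0.ne'
    have hνne : ν ≠ 0 := hν.ne'
    have hCne : Cp ≠ 0 := hCp0.ne'
    have hw1 : (1 + w) ≠ 0 := by positivity
    rw [hD]
    field_simp
    ring

/-! ### The weighted measure `dx/r` and the `L^{2k}` norms of `ω_θ = rη` -/

/-- The measure `r⁻¹ dx` on `ℝ³` charges every nonempty open set (the axis is Lebesgue-null and
`r⁻¹ > 0` off it). [folklore] -/
private theorem isOpenPosMeasure_withDensity_inv_cylRadius :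
    (volume.withDensity fun y : EuclideanSpace ℝ (Fin 3) => ENNReal.ofReal (cylRadius y)⁻¹).IsOpenPosMeasure := by
  refine ⟨fun U hU hne => ?_⟩
  have hmeas : Measurable fun y : EuclideanSpace ℝ (Fin 3) => ENNReal.ofReal (cylRadius y)⁻¹ :=
    ENNReal.measurable_ofReal.comp continuous_cylRadius.measurable.inv
  rw [Ne, withDensity_apply_eq_zero' hmeas.aemeasurable]
  have hset : {x : EuclideanSpace ℝ (Fin 3) | ENNReal.ofReal (cylRadius x)⁻¹ ≠ 0} ∩ U =
      U \ {x | cylRadius x = 0} := by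
    ext x
    simp only [mem_inter_iff, mem_setOf_eq, Set.mem_sdiff, ne_eq, ENNReal.ofReal_eq_zero, not_le, inv_pos]
    constructor
    · rintro ⟨h1, h2⟩; exact ⟨h2, h1.ne'⟩
    · rintro ⟨h2, h1⟩; exact ⟨lt_of_le_of_ne (cylRadius_nonneg x) (Ne.symm h1), h2⟩
  rw [hset, measure_sdiff_null volume_setOf_cylRadius_eq_zero]
  exact (hU.measure_pos volume hne).ne'

/-- `∫ |rη|^{2k} r⁻¹ dx = ∫ r^{2k−1} η^{2k} dx` (`k ≥ 1`), as an `ℝ≥0∞`-valued identity for a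
continuous `η` with `r^{2k−1}η^{2k} ∈ L¹`. [folklore] -/
private theorem lintegral_withDensity_inv_cylRadius_pow {η : EuclideanSpace ℝ (Fin 3) → ℝ}
    (hηc : Continuous η) {k : ℕ} (hk : 1 ≤ k)
    (hI : Integrable fun x => cylRadius x ^ (2 * k - 1) * η x ^ (2 * k)) :
    ∫⁻ x, ‖cylRadius x * η x‖ₑ ^ (((2 * k : ℕ) : ℝ))
        ∂(volume.withDensity fun y : EuclideanSpace ℝ (Fin 3) => ENNReal.ofReal (cylRadius y)⁻¹) =
      ENNReal.ofReal (∫ x, cylRadius x ^ (2 * k - 1) * η x ^ (2 * k)) := by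
  have hmeas : Measurable fun y : EuclideanSpace ℝ (Fin 3) => ENNReal.ofReal (cylRadius y)⁻¹ :=
    ENNReal.measurable_ofReal.comp continuous_cylRadius.measurable.inv
  have hg : Measurable fun x : EuclideanSpace ℝ (Fin 3) => ‖cylRadius x * η x‖ₑ ^ (((2 * k : ℕ) : ℝ)) :=
    (continuous_cylRadius.mul hηc).measurable.enorm.pow_const _
  obtain ⟨i, rfl⟩ : ∃ i, k = i + 1 := ⟨k - 1, by omega⟩
  have e1 : 2 * (i + 1) - 1 = 2 * i + 1 := by omega
  have e2 : 2 * (i + 1) = 2 * i + 2 := by omega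
  have hnn : ∀ x, 0 ≤ cylRadius x ^ (2 * (i + 1) - 1) * η x ^ (2 * (i + 1)) := fun x =>
    mul_nonneg (pow_nonneg (cylRadius_nonneg x) _) ((even_two_mul _).pow_nonneg _)
  rw [lintegral_withDensity_eq_lintegral_mul _ hmeas hg,
    ofReal_integral_eq_lintegral_ofReal hI (ae_of_all _ hnn)]
  refine lintegral_congr fun x => ?_
  simp only [Pi.mul_apply]
  have hr := cylRadius_nonneg x
  rw [ENNReal.rpow_natCast, ← ofReal_norm, norm_mul, Real.norm_eq_abs, Real.norm_eq_abs, abs_of_nonneg hr,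
    ← ENNReal.ofReal_pow (by positivity), ← ENNReal.ofReal_mul (inv_nonneg.2 hr)]
  congr 1
  rw [e1, e2, mul_pow, (show Even (2 * i + 2) from ⟨i + 1, by ring⟩).pow_abs]
  rcases hr.eq_or_lt with h0 | hpos
  · rw [← h0]; simp
  · field_simp
    ring

/-! ### `p → ∞`: the sup bound for `ω_θ = rη` -/

/-- **`t · |ω_θ(t, x)| ≤ 3C⁺(1+w)A/ν`** along the slices (`A = ∫|η(0)| > 0`, `u_r/r ≤ w/τ`): the
`L^{2k}(Ω)` bounds along `k = 3·2ⁿ` and `k → ∞` on the continuous slice `rη(t)` for the measure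
`r⁻¹dx` (`norm_le_of_lintegral_rpow_le_of_tendsto` with `B_n = L c₀^{1/(2k_n)} → L`,
`L = (6Dβ₀)^{1/6}/t ≤ 3C⁺(1+w)A/(νt)`). [cite: GallaySverak2016, Prop. 5.3 with p = ∞, (1.11)
(arXiv pp. 4, 16–17); FengSverak2015, proof of Lemma 3.8, `p → ∞` (arXiv p. 12)] -/
private theorem sup_bound (h : IsTaoSolutionOn T ν u₀ v q) (hT : 0 < T) (hν : 0 < ν)
    (hax : ∀ t ∈ Icc 0 T, IsAxisymmetric (v t)) (hsw : ∀ t ∈ Icc 0 T, HasNoSwirl (v t))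
    (hL1 : Integrable (angVortQuot (v 0))) (hA : 0 < ∫ x, |angVortQuot (v 0) x|)
    {w : ℝ} (hw : 0 ≤ w) (hW : ∀ τ ∈ Ioc 0 T, ∀ x, radVelQuot (v τ) x ≤ w * τ⁻¹)
    {t : ℝ} (ht : t ∈ Ioc 0 T) (x : EuclideanSpace ℝ (Fin 3)) :
    t * (cylRadius x * |angVortQuot (v t) x|) ≤
      3 * max (32 * (lintegralPowLePowLIntegralFDerivConst (volume : Measure (EuclideanSpace ℝ (Fin 2))) 2 : ℝ) /
        radialConst₂) 1 * (1 + w) / ν * ∫ x, |angVortQuot (v 0) x| := by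
  set Cp : ℝ := max (32 * (lintegralPowLePowLIntegralFDerivConst
    (volume : Measure (EuclideanSpace ℝ (Fin 2))) 2 : ℝ) / radialConst₂) 1 with hCp
  set A : ℝ := ∫ x, |angVortQuot (v 0) x| with hAdef
  set D : ℝ := Cp * (1 + w) / ν with hD
  set β₀ : ℝ := (3 * Cp * (1 + w) / (2 * ν)) ^ 5 * A ^ 6 with hβ₀
  set P : ℝ := 6 * D * β₀ with hP
  have hCp0 : 0 < Cp := one_pos.trans_le (le_max_right _ _)
  have hD0 : 0 < D := by rw [hD]; positivity
  have hβ₀0 : 0 < β₀ := by rw [hβ₀]; positivity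
  have hP0 : 0 < P := by rw [hP]; positivity
  have htpos : 0 < t := ht.1
  have htI : t ∈ Icc 0 T := ⟨ht.1.le, ht.2⟩
  -- the limit `L` and the correction `c₀`
  set L : ℝ := P ^ (1 / 6 : ℝ) * t⁻¹ with hL
  set c₀ : ℝ := t / (6 * D) with hc₀def
  have hc₀ : 0 < c₀ := by rw [hc₀def]; positivity
  have hL0 : 0 ≤ L := by rw [hL]; positivity
  -- `P^{1/6} ≤ 3 C⁺ (1+w) A/ν`
  have hP6 : P ^ (1 / 6 : ℝ) ≤ 3 * Cp * (1 + w) / ν * A := by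
    have hY : 0 ≤ 3 * Cp * (1 + w) / ν * A := by positivity
    have hPQ : P ≤ (3 * Cp * (1 + w) / ν * A) ^ 6 := by
      have hY6 : 0 ≤ (Cp * (1 + w) / ν * A) ^ 6 := by positivity
      have e1 : P = 729 / 16 * (Cp * (1 + w) / ν * A) ^ 6 := by
        rw [hP, hD, hβ₀]; ring
      have e2 : (3 * Cp * (1 + w) / ν * A) ^ 6 = 729 * (Cp * (1 + w) / ν * A) ^ 6 := by ring
      rw [e1, e2]
      nlinarith
    calc P ^ (1 / 6 : ℝ) ≤ ((3 * Cp * (1 + w) / ν * A) ^ 6) ^ (1 / 6 : ℝ) :=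
          Real.rpow_le_rpow hP0.le hPQ (by norm_num)
      _ = 3 * Cp * (1 + w) / ν * A := by
          rw [one_div]; exact Real.pow_rpow_inv_natCast hY (by norm_num)
  -- it suffices to bound `‖rη(t,x)‖ ≤ L`
  suffices hmain : ‖cylRadius x * angVortQuot (v t) x‖ ≤ L by
    rw [Real.norm_eq_abs, abs_mul, abs_of_nonneg (cylRadius_nonneg x), hL] at hmain
    calc t * (cylRadius x * |angVortQuot (v t) x|) ≤ t * (P ^ (1 / 6 : ℝ) * t⁻¹) :=
          mul_le_mul_of_nonneg_left hmain htpos.le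
      _ = P ^ (1 / 6 : ℝ) := by field_simp
      _ ≤ 3 * Cp * (1 + w) / ν * A := hP6
  -- the weighted measure and the continuous slice
  haveI := isOpenPosMeasure_withDensity_inv_cylRadius
  have hηc : Continuous (angVortQuot (v t)) :=
    (contDiff_angVortQuot_of_contDiff (h.classical.contDiff_velocity htI)).continuous
  have hfc : Continuous fun y => cylRadius y * angVortQuot (v t) y := continuous_cylRadius.mul hηc
  refine norm_le_of_lintegral_rpow_le_of_tendsto
    (μ := volume.withDensity fun y : EuclideanSpace ℝ (Fin 3) => ENNReal.ofReal (cylRadius y)⁻¹) hfc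
    (p := fun n => ((2 * (3 * 2 ^ n) : ℕ) : ℝ)) (B := fun n => L * c₀ ^ (1 / ((2 * (3 * 2 ^ n) : ℕ) : ℝ)))
    (L := L) (fun n => by positivity) ?_ (fun n => by positivity) ?_ ?_ x
  · -- `6·2ⁿ → ∞`
    have h1 : Tendsto (fun n : ℕ => (6 : ℝ) * 2 ^ n) atTop atTop :=
      (tendsto_pow_atTop_atTop_of_one_lt one_lt_two).const_mul_atTop (by norm_num)
    refine h1.congr fun n => ?_
    push_cast; ring
  · -- `B_n → L`
    have hp : Tendsto (fun n : ℕ => ((2 * (3 * 2 ^ n) : ℕ) : ℝ)) atTop atTop := by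
      have h1 : Tendsto (fun n : ℕ => (6 : ℝ) * 2 ^ n) atTop atTop :=
        (tendsto_pow_atTop_atTop_of_one_lt one_lt_two).const_mul_atTop (by norm_num)
      refine h1.congr fun n => ?_
      push_cast; ring
    have h1 : Tendsto (fun n : ℕ => 1 / ((2 * (3 * 2 ^ n) : ℕ) : ℝ)) atTop (𝓝 0) :=
      tendsto_const_nhds.div_atTop hp
    have h2 : Tendsto (fun n : ℕ => c₀ ^ (1 / ((2 * (3 * 2 ^ n) : ℕ) : ℝ))) atTop (𝓝 (c₀ ^ (0 : ℝ))) :=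
      ((Real.continuousAt_const_rpow hc₀.ne').tendsto).comp h1
    rw [Real.rpow_zero] at h2
    simpa using h2.const_mul L
  · -- the bounds `∫ |ω_θ(t)|^{2k} r⁻¹dx ≤ ofReal (B_n^{2k})`, `k = 3·2ⁿ`
    intro n
    set K : ℕ := 3 * 2 ^ n with hK
    have hK1 : 1 ≤ K := by rw [hK]; exact Nat.le_mul_of_pos_right 3 (Nat.two_pow_pos n) |>.trans' (by norm_num)
    have hKpos : (0 : ℝ) < K := by exact_mod_cast hK1
    have hmain := iterate h hT hν hax hsw hL1 hA hw hW n ht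
    rw [← hCp, ← hAdef] at hmain
    rw [← hD, ← hβ₀] at hmain
    rw [← hP] at hmain
    obtain ⟨-, hI, -, -⟩ := nash_slice h hax (k := K)
      (by rw [hK]; exact Nat.le_mul_of_pos_right 3 (Nat.two_pow_pos n)) htI
    show ∫⁻ y, ‖cylRadius y * angVortQuot (v t) y‖ₑ ^ (((2 * K : ℕ) : ℝ))
        ∂(volume.withDensity fun y : EuclideanSpace ℝ (Fin 3) => ENNReal.ofReal (cylRadius y)⁻¹) ≤
      ENNReal.ofReal ((L * c₀ ^ (1 / ((2 * K : ℕ) : ℝ))) ^ (((2 * K : ℕ) : ℝ)))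
    rw [lintegral_withDensity_inv_cylRadius_pow hηc hK1 hI]
    refine ENNReal.ofReal_le_ofReal (hmain.trans ?_)
    -- `β_n t^{-(2K-1)} ≤ (L c₀^{1/(2K)})^{2K} = L^{2K} c₀`
    have h2K0 : (2 * K : ℕ) ≠ 0 := by omega
    have e2 : (L * c₀ ^ (1 / ((2 * K : ℕ) : ℝ))) ^ (((2 * K : ℕ) : ℝ)) = L ^ (2 * K) * c₀ := by
      rw [Real.rpow_natCast, mul_pow, one_div, Real.rpow_inv_natCast_pow hc₀.le h2K0]
    rw [e2, hL, mul_pow (P ^ (1 / 6 : ℝ)) t⁻¹ (2 * K), ← Real.rpow_natCast (P ^ (1 / 6 : ℝ)) (2 * K),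
      ← Real.rpow_mul hP0.le]
    have e3 : (1 / 6 : ℝ) * ((2 * K : ℕ) : ℝ) = ((2 ^ n : ℕ) : ℝ) := by
      rw [hK]; push_cast; ring
    rw [e3, Real.rpow_natCast]
    -- now: `P^(2^n)/(6 D 2^n) * t^(-(2K-1)) ≤ P^(2^n) * (t⁻¹)^(2K) * (t/(6D))`
    have e4 : (P : ℝ) ^ (2 ^ n) * t⁻¹ ^ (2 * K) * c₀ = P ^ (2 ^ n) / (6 * D) * t ^ (-(2 * (K : ℝ) - 1)) := by
      rw [hc₀def]
      have e5 : t ^ (-(2 * (K : ℝ) - 1)) = t⁻¹ ^ (2 * K) * t := by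
        rw [show (-(2 * (K : ℝ) - 1)) = -((2 * K : ℕ) : ℝ) + 1 by push_cast; ring,
          Real.rpow_add htpos, Real.rpow_one, Real.rpow_neg htpos.le, Real.rpow_natCast, inv_pow]
      rw [e5]
      field_simp
    rw [e4]
    have hT0 : 0 ≤ t ^ (-(2 * (K : ℝ) - 1)) := Real.rpow_nonneg htpos.le _
    refine mul_le_mul_of_nonneg_right ?_ hT0
    -- `P^(2^n)/(6D 2^n) ≤ P^(2^n)/(6D)`
    have h2n : (1 : ℝ) ≤ 2 ^ n := one_le_pow₀ one_le_two
    exact div_le_div_of_nonneg_left (by positivity) (by positivity)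
      (le_mul_of_one_le_right (by positivity) h2n)

end AxisymNoSwirlVorticitySupBound

open AxisymNoSwirlVorticitySupBound

/-! ### The scale-invariant vorticity bound -/

section Main

variable {T ν : ℝ} {u₀ : EuclideanSpace ℝ (Fin 3) → EuclideanSpace ℝ (Fin 3)}
  {u : ℝ → EuclideanSpace ℝ (Fin 3) → EuclideanSpace ℝ (Fin 3)} {p : ℝ → EuclideanSpace ℝ (Fin 3) → ℝ}

/-- **Gallay–Šverák's scale-invariant vorticity bound (1.11) = Prop. 5.3 for `p = ∞`, with explicit
constants.** Let `(u, p)` be a Tao-class solution of the unforced Navier–Stokes system on `[0, T] × ℝ³`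
with viscosity `ν > 0` whose datum `u₀` is axisymmetric WITHOUT swirl with
`η₀ = ω_θ(0)/r = angVortQuot u₀ ∈ L¹(ℝ³)`, `A = ∫|η₀| dx = 2π‖ω₀‖_{L¹(Ω)}`. Then for `t ∈ (0, T]` and
every `x`:

  `t · ‖ω(t, x)‖ ≤ 3 C⁺ (1 + (27K₁²/(4ν)) A) A / ν`,

`C⁺ = max(32 C_GNS(ℝ²)/c₂, 1)` (Nash's constant on `Ω`), `K₁ = max(K_GNS(ℝ³), 1)`. The printed
`‖ω_θ(t)‖_{L^∞(Ω)} ≤ C(‖ω₀‖_{L¹(Ω)})/t`, `C(s) = O(s)` as `s → 0`; here `C` is a quadratic polynomial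
in `A` (the `u_r/r` transport term contributes the factor `1 + ‖u_r/r‖_∞ t`, bounded by Lemma 5.2 and
(2.15)). [cite: GallaySverak2016, §1 (1.11) (arXiv p. 4) and §5 Prop. 5.3 with its proof (arXiv pp. 16–17)] -/
theorem IsTaoSolutionOn.mul_norm_curl_le_of_datum (h : IsTaoSolutionOn T ν u₀ u p) (hT : 0 < T)
    (hν : 0 < ν) (h0 : IsAxisymmetric u₀) (h0' : HasNoSwirl u₀) (hL1 : Integrable (angVortQuot u₀))
    {t : ℝ} (ht : t ∈ Ioc 0 T) (x : EuclideanSpace ℝ (Fin 3)) :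
    t * ‖curl (u t) x‖ ≤
      3 * max (32 * (lintegralPowLePowLIntegralFDerivConst (volume : Measure (EuclideanSpace ℝ (Fin 2))) 2 : ℝ) /
          radialConst₂) 1 *
        (1 + 27 * (max ((SNormLESNormFDerivOfEqConst ℝ (volume : Measure (EuclideanSpace ℝ (Fin 3))) 2 : ℝ)) 1) ^ 2 /
          (4 * ν) * ∫ y, |angVortQuot u₀ y|) / ν * ∫ y, |angVortQuot u₀ y| := by
  set Cp : ℝ := max (32 * (lintegralPowLePowLIntegralFDerivConst
    (volume : Measure (EuclideanSpace ℝ (Fin 2))) 2 : ℝ) / radialConst₂) 1 with hCp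
  set K₁ : ℝ := max ((SNormLESNormFDerivOfEqConst ℝ (volume : Measure (EuclideanSpace ℝ (Fin 3))) 2 : ℝ)) 1
    with hK₁
  set A : ℝ := ∫ y, |angVortQuot u₀ y| with hAdef
  have hCp0 : 0 < Cp := one_pos.trans_le (le_max_right _ _)
  have hA0 : 0 ≤ A := integral_nonneg fun y => abs_nonneg _
  have htI : t ∈ Icc 0 T := ⟨ht.1.le, ht.2⟩
  have hax := h.isAxisymmetric hν hT h0
  have hsw := h.hasNoSwirl hν hT h0 h0'
  have hv3 : ContDiff ℝ 3 (u t) := (h.classical.contDiff_velocity htI).of_le (by norm_cast)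
  have hL1' : Integrable (angVortQuot (u 0)) := by rw [h.initial]; exact hL1
  have hA' : (∫ y, |angVortQuot (u 0) y|) = A := by rw [h.initial]
  rw [norm_curl_eq_cylRadius_mul_abs_angVortQuot (hax t htI) (hsw t htI) hv3 x]
  -- the transport bound `u_r/r ≤ w/τ`, `w = (27K₁²/(4ν)) A`
  set w : ℝ := 27 * K₁ ^ 2 / (4 * ν) * A with hw
  have hw0 : 0 ≤ w := by rw [hw]; positivity
  have hW : ∀ τ ∈ Ioc 0 T, ∀ y, radVelQuot (u τ) y ≤ w * τ⁻¹ := fun τ hτ y =>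
    (le_abs_self _).trans (h.abs_radVelQuot_le_nash_of_datum hT hν h0 h0' hL1 hτ y)
  rcases hA0.eq_or_lt with hA | hA
  · -- `A = 0`: `η₀ = 0` a.e., hence `η(t) ≡ 0` (Lemma 5.1 and continuity)
    obtain ⟨hint, hle⟩ := l1_slice h hT hν.le hax hsw hL1' htI
    rw [hA', ← hA] at hle
    have hzero : ∫ y, |angVortQuot (u t) y| = 0 :=
      le_antisymm hle (integral_nonneg fun y => abs_nonneg _)
    have hae : (fun y => |angVortQuot (u t) y|) =ᵐ[volume] 0 :=
      (integral_eq_zero_iff_of_nonneg (fun y => abs_nonneg _) hint.abs).1 hzero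
    have hηc : Continuous (angVortQuot (u t)) :=
      (contDiff_angVortQuot_of_contDiff (h.classical.contDiff_velocity htI)).continuous
    have hfun : (fun y => |angVortQuot (u t) y|) = 0 :=
      (Continuous.ae_eq_iff_eq volume (continuous_abs.comp hηc) continuous_const).1 hae
    have hx : |angVortQuot (u t) x| = 0 := by
      have := congrFun hfun x
      simpa using this
    rw [hx, ← hA]
    simp
  · have hmain := sup_bound h hT hν hax hsw hL1' (by rwa [hA']) hw0 hW ht x
    rw [hA'] at hmain
    exact hmain

end Main

/-! ### The discharges -/

namespace GallaySverak2015

/-- **`GallaySverak2015.VorticitySupBound` holds**: the named fact (1.11) of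
`AxisymNoSwirlScaleInvariantBounds.lean` — `t‖ω(t,·)‖_{L^∞} ≤ C(‖ω₀‖_{L¹(Ω)})` with `C(s) = O(s)`
as `s → 0` for Tao-class solutions (`ν = 1`) from axisymmetric swirl-free data with `ω₀/r ∈ L¹` —
with `C(M) = 3C⁺ (1 + (27K₁²/4)·2πM)·2πM` (`A = 2πM`), `C(s) ≤ 6πC⁺(1 + (27K₁²/2)π) s` on `[0, 1]`.
[cite: GallaySverak2016, §1 (1.11) (arXiv p. 4); §5 Prop. 5.3 (arXiv pp. 16–17)] -/
theorem VorticitySupBound_holds : VorticitySupBound := by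
  set Cp : ℝ := max (32 * (lintegralPowLePowLIntegralFDerivConst
    (volume : Measure (EuclideanSpace ℝ (Fin 2))) 2 : ℝ) / radialConst₂) 1 with hCp
  set K₁ : ℝ := max ((SNormLESNormFDerivOfEqConst ℝ (volume : Measure (EuclideanSpace ℝ (Fin 3))) 2 : ℝ)) 1
    with hK₁
  have hCp0 : 0 < Cp := one_pos.trans_le (le_max_right _ _)
  refine ⟨fun s => 3 * Cp * (1 + 27 * K₁ ^ 2 / (4 * 1) * (2 * Real.pi * s)) / 1 * (2 * Real.pi * s),
    ⟨3 * Cp * (1 + 27 * K₁ ^ 2 / (4 * 1) * (2 * Real.pi * 1)) / 1 * (2 * Real.pi), 1, one_pos,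
      fun s hs0 hs1 => ?_⟩, ?_⟩
  · -- `C(s) ≤ K s` on `[0, 1]`
    have hπ : 0 < Real.pi := Real.pi_pos
    have h1 : 1 + 27 * K₁ ^ 2 / (4 * 1) * (2 * Real.pi * s) ≤ 1 + 27 * K₁ ^ 2 / (4 * 1) * (2 * Real.pi * 1) := by
      have : 2 * Real.pi * s ≤ 2 * Real.pi * 1 := mul_le_mul_of_nonneg_left hs1 (by positivity)
      have hK : 0 ≤ 27 * K₁ ^ 2 / (4 * 1) := by positivity
      nlinarith
    have h2 : 0 ≤ 3 * Cp * (2 * Real.pi * s) := by positivity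
    calc 3 * Cp * (1 + 27 * K₁ ^ 2 / (4 * 1) * (2 * Real.pi * s)) / 1 * (2 * Real.pi * s)
        = (1 + 27 * K₁ ^ 2 / (4 * 1) * (2 * Real.pi * s)) * (3 * Cp * (2 * Real.pi * s)) := by ring
      _ ≤ (1 + 27 * K₁ ^ 2 / (4 * 1) * (2 * Real.pi * 1)) * (3 * Cp * (2 * Real.pi * s)) :=
          mul_le_mul_of_nonneg_right h1 h2
      _ = 3 * Cp * (1 + 27 * K₁ ^ 2 / (4 * 1) * (2 * Real.pi * 1)) / 1 * (2 * Real.pi) * s := by ring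
  · intro T u₀ u p hT h h0 h0' hL1 t ht x
    have hb := h.mul_norm_curl_le_of_datum hT one_pos h0 h0' hL1 ht x
    have hA : 2 * Real.pi * ((2 * Real.pi)⁻¹ * ∫ y, |angVortQuot u₀ y|) = ∫ y, |angVortQuot u₀ y| := by
      have hπ : (2 * Real.pi) ≠ 0 := by positivity
      rw [← mul_assoc, mul_inv_cancel₀ hπ, one_mul]
    show t * ‖curl (u t) x‖ ≤ 3 * Cp * (1 + 27 * K₁ ^ 2 / (4 * 1) *
      (2 * Real.pi * ((2 * Real.pi)⁻¹ * ∫ y, |angVortQuot u₀ y|))) / 1 *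
      (2 * Real.pi * ((2 * Real.pi)⁻¹ * ∫ y, |angVortQuot u₀ y|))
    rw [hA]
    exact hb

/-- **`GallaySverak2015.VelocitySupDecay` holds**: (1.12) `√t‖u(t)‖_{L^∞} ≤ C(‖ω₀‖_{L¹(Ω)})`,
`C(s) = O(s)`, for Tao-class solutions (`ν = 1`) from axisymmetric swirl-free data with `ω₀/r ∈ L¹`
— from (1.11) through the tree's `velocitySupDecay_of_vorticitySupBound` (the axisymmetric
Biot–Savart bound (2.12) with Lemma 5.1). [cite: GallaySverak2016, §1 (1.12) (arXiv p. 4); §5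
(5.12) (arXiv p. 17)] -/
theorem VelocitySupDecay_holds : VelocitySupDecay :=
  velocitySupDecay_of_vorticitySupBound VorticitySupBound_holds

end GallaySverak2015

end Literature.Analysis.FluidPDE

end
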